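import Mathlib.LinearAlgebra.Matrix.ToLinearEquiv
import Mathlib.LinearAlgebra.LinearIndependent.Lemmas
import Literature.RingTheory.MvPolynomial.RuppertReducibleProofs
import HarnessLib

/-!
# Ruppert's matrix: kernel pairs versus maximal minors

Sibling proof file of `RuppertMatrix.lean` (W. M. Ruppert, *Reducibility of polynomials `f(x, y)`
modulo `p`*, J. Number Theory 77 (1999) 62–70, §2: "equation (1) has a nontrivial solution iff
`M(f)` has rank `< 2mn+n−1`, i.e. all `(2mn+n−1) × (2mn+n−1)`-submatrices of `M(f)` vanish";
"Then the matrix `M(f)` has rank `2mn+n−1`, i.e. there is a `(2mn+n−1) × (2mn+n−1)`-submatrix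
`M₀` of `M(f)` with `det M₀ ≠ 0`"). In our total-degree normalisation the kernel always contains
the line of `(φ_X, φ_Y)`, so "rank" is measured against `N − 1`, `N = |Col d|` the number of
unknowns.

## What is proved (no definitions, no named facts)

* `Ruppert.rupMinor_eq_zero_of_two_kernel_pairs` — two linearly independent kernel pairs in the
  box force every minor of size `≥ N − 1` to vanish;
* `Ruppert.exists_rupMinor_ne_zero_of_kernel_line` — if every kernel pair in the box is a
  multiple of `(φ_X, φ_Y)` and this pair has a non-zero coordinate, some minor of size `N − 1`
  is non-zero (linear algebra: independent columns admit a non-singular maximal square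
  submatrix, by Laplace expansion and induction);
* `Ruppert.rupMinor_eq_zero_of_not_irreducible` — the combination with Ruppert's Lemma 1
  (`two_kernel_pairs_of_not_irreducible`);
* cardinality bookkeeping `card_Col_le : N ≤ 2d²`.

## References

* W. M. Ruppert, J. Number Theory 77 (1999) 62–70, §2. [`Ruppert1999`]
-/

noncomputable section

open MvPolynomial

namespace Literature.RingTheory.MvPolynomial

namespace Ruppert

variable {F : Type*} [Field F]

/-! ### Linear algebra: independent columns have a non-singular maximal square submatrix -/

/-- **Independent columns admit a non-singular square row-selection.** If `b₀, …, b_{n−1}` are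
linearly independent vectors of `F^Row` (`Row` finite), some `n` rows `r` give
`det (b_j(r_i)) ≠ 0`. (Induction on `n` with Laplace expansion along the new row: if all the
bordered determinants vanished, the cofactors would give a non-trivial relation.) [folklore] -/
theorem exists_rows_det_ne_zero {Row : Type*} :
    ∀ (n : ℕ) (b : Fin n → Row → F), LinearIndependent F b →
      ∃ r : Fin n → Row, (Matrix.of fun i j => b j (r i)).det ≠ 0 := by
  intro n
  induction n with
  | zero =>
    intro b _
    refine ⟨Fin.elim0, ?_⟩
    rw [Matrix.det_fin_zero]
    exact one_ne_zero
  | succ n ih =>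
    intro b hb
    -- rows for the tail family
    have htail : LinearIndependent F (fun j : Fin n => b j.succ) := hb.comp _ (Fin.succ_injective n)
    obtain ⟨r, hr⟩ := ih _ htail
    -- the bordered matrices
    let A : Row → Matrix (Fin (n + 1)) (Fin (n + 1)) F := fun ρ =>
      Matrix.of fun i j => b j ((Fin.cons ρ r : Fin (n + 1) → Row) i)
    -- cofactors (independent of `ρ`)
    let M : Fin (n + 1) → Matrix (Fin n) (Fin n) F := fun j =>
      Matrix.of fun i l => b (j.succAbove l) (r i)
    have hsub : ∀ ρ j, (A ρ).submatrix Fin.succ j.succAbove = M j := by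
      intro ρ j
      ext i l
      simp [A, M]
    have hexp : ∀ ρ, (A ρ).det = ∑ j : Fin (n + 1), (-1) ^ (j : ℕ) * b j ρ * (M j).det := by
      intro ρ
      rw [Matrix.det_succ_row_zero]
      refine Finset.sum_congr rfl fun j _ => ?_
      rw [hsub]
      simp [A]
    have hM0 : (M 0).det ≠ 0 := by
      have : M 0 = Matrix.of fun i j => b j.succ (r i) := by
        ext i l; simp [M]
      rwa [this]
    -- some bordered determinant is non-zero
    by_cases hex : ∃ ρ, (A ρ).det ≠ 0
    · obtain ⟨ρ, hρ⟩ := hex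
      exact ⟨Fin.cons ρ r, hρ⟩
    · exfalso
      push Not at hex
      have hrel : ∑ j : Fin (n + 1), ((-1) ^ (j : ℕ) * (M j).det) • b j = 0 := by
        funext ρ
        rw [Finset.sum_apply, Pi.zero_apply, ← hex ρ, hexp ρ]
        refine Finset.sum_congr rfl fun j _ => ?_
        rw [Pi.smul_apply, smul_eq_mul]
        ring
      have := Fintype.linearIndependent_iff.mp hb _ hrel 0
      simp only [Fin.val_zero, pow_zero, one_mul] at this
      exact hM0 this

/-! ### Cardinalities -/

/-- The box of degree `≤ k` has at most `(k+1)²` exponents. [folklore] -/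
theorem card_box_le (k : ℕ) : (box k).card ≤ (k + 1) ^ 2 := by
  unfold box
  refine (Finset.card_filter_le _ _).trans ?_
  refine Finset.card_image_le.trans ?_
  rw [Finset.card_product, Finset.card_range, sq]

/-- `0` lies in every box. [folklore] -/
theorem zero_mem_box (k : ℕ) : (0 : Fin 2 →₀ ℕ) ∈ box k := mem_box.mpr (by simp)

/-- `N = |Col d| ≤ 2d²` for `d ≥ 1`. [folklore] -/
theorem card_Col_le {d : ℕ} (hd : 1 ≤ d) : Fintype.card (Col d) ≤ 2 * d ^ 2 := by
  rw [Fintype.card_prod, Fintype.card_fin, Fintype.card_coe]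
  have := card_box_le (d - 1)
  rw [Nat.sub_add_cancel hd] at this
  omega

/-- `N = |Col d| ≥ 2`. [folklore] -/
theorem two_le_card_Col (d : ℕ) : 2 ≤ Fintype.card (Col d) := by
  rw [Fintype.card_prod, Fintype.card_fin, Fintype.card_coe]
  have : 1 ≤ (box (d - 1)).card := Finset.card_pos.mpr ⟨0, zero_mem_box _⟩
  omega

/-! ### Kernel pairs and coefficient vectors -/

/-- A kernel pair in the box gives a kernel vector of the matrix. [folklore] -/
theorem sum_rupMat_pairVec_eq_zero {d : ℕ} {φ G H : MvPolynomial (Fin 2) F}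
    (hG : G.totalDegree ≤ d - 1) (hH : H.totalDegree ≤ d - 1) (hR : rupOp φ G H = 0)
    (e' : Fin 2 →₀ ℕ) : ∑ c : Col d, rupMat d φ e' c * pairVec d G H c = 0 := by
  rw [← coeff_rupOp_eq_sum_rupMat φ hG hH, hR, coeff_zero]

/-- `pairVec` is additive. [folklore] -/
theorem pairVec_add (d : ℕ) (G₁ H₁ G₂ H₂ : MvPolynomial (Fin 2) F) :
    pairVec d (G₁ + G₂) (H₁ + H₂) = pairVec d G₁ H₁ + pairVec d G₂ H₂ := by
  funext c
  by_cases h : c.1 = 0 <;> simp [pairVec, h]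

/-- `pairVec` is homogeneous. [folklore] -/
theorem pairVec_smul (d : ℕ) (a : F) (G H : MvPolynomial (Fin 2) F) :
    pairVec d (a • G) (a • H) = a • pairVec d G H := by
  funext c
  by_cases h : c.1 = 0 <;> simp [pairVec, h]

/-- A pair in the box with zero coefficient vector is zero. [folklore] -/
theorem eq_zero_of_pairVec_eq_zero {d : ℕ} {G H : MvPolynomial (Fin 2) F}
    (hG : G.totalDegree ≤ d - 1) (hH : H.totalDegree ≤ d - 1) (h : pairVec d G H = 0) :
    G = 0 ∧ H = 0 := by
  have := vecPair_pairVec hG hH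
  rw [h] at this
  have h0 : vecPair d (0 : Col d → F) = (0, 0) := by
    unfold vecPair; simp
  rw [h0] at this
  exact ⟨(Prod.mk.inj this).1.symm, (Prod.mk.inj this).2.symm⟩

/-! ### Two kernel pairs kill the large minors -/

/-- **Two independent kernel pairs force all minors of size `≥ N − 1` to vanish** (Ruppert:
"equation (1) has a nontrivial solution iff … all submatrices vanish", adapted to the kernel
line always present in the total-degree normalisation). [cite: Ruppert1999, §2] -/
theorem rupMinor_eq_zero_of_two_kernel_pairs {d : ℕ} {φ : MvPolynomial (Fin 2) F}
    (h : ∃ G₁ H₁ G₂ H₂ : MvPolynomial (Fin 2) F,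
      G₁.totalDegree ≤ d - 1 ∧ H₁.totalDegree ≤ d - 1 ∧ G₂.totalDegree ≤ d - 1 ∧
        H₂.totalDegree ≤ d - 1 ∧ rupOp φ G₁ H₁ = 0 ∧ rupOp φ G₂ H₂ = 0 ∧
        ∀ a b : F, a • G₁ + b • G₂ = 0 → a • H₁ + b • H₂ = 0 → a = 0 ∧ b = 0)
    {m : ℕ} (hm : Fintype.card (Col d) ≤ m + 1) (r : Fin m → (Fin 2 →₀ ℕ)) (c : Fin m → Col d) :
    rupMinor d φ r c = 0 := by
  classical
  obtain ⟨G₁, H₁, G₂, H₂, hG₁, hH₁, hG₂, hH₂, hR₁, hR₂, hind⟩ := h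
  set x₁ := pairVec d G₁ H₁ with hx₁
  set x₂ := pairVec d G₂ H₂ with hx₂
  have hk₁ := sum_rupMat_pairVec_eq_zero hG₁ hH₁ hR₁ (d := d)
  have hk₂ := sum_rupMat_pairVec_eq_zero hG₂ hH₂ hR₂ (d := d)
  -- independence of the coefficient vectors
  have hindv : ∀ a b : F, a • x₁ + b • x₂ = 0 → a = 0 ∧ b = 0 := by
    intro a b hab
    have hvec : pairVec d (a • G₁ + b • G₂) (a • H₁ + b • H₂) = 0 := by
      rw [pairVec_add, pairVec_smul, pairVec_smul]; exact hab
    have hdegG : (a • G₁ + b • G₂).totalDegree ≤ d - 1 :=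
      (totalDegree_add _ _).trans (max_le ((totalDegree_smul_le _ _).trans hG₁)
        ((totalDegree_smul_le _ _).trans hG₂))
    have hdegH : (a • H₁ + b • H₂).totalDegree ≤ d - 1 :=
      (totalDegree_add _ _).trans (max_le ((totalDegree_smul_le _ _).trans hH₁)
        ((totalDegree_smul_le _ _).trans hH₂))
    obtain ⟨h1, h2⟩ := eq_zero_of_pairVec_eq_zero hdegG hdegH hvec
    exact hind a b h1 h2
  have hx₁0 : x₁ ≠ 0 := fun h0 => by
    have := hindv 1 0 (by rw [h0]; simp)
    exact one_ne_zero this.1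
  unfold rupMinor
  -- non-injective columns: two equal columns
  by_cases hc : Function.Injective c
  swap
  · obtain ⟨j₁, j₂, hj, hne⟩ : ∃ j₁ j₂, c j₁ = c j₂ ∧ j₁ ≠ j₂ := by
      unfold Function.Injective at hc; push Not at hc
      obtain ⟨a, b, hab, hne⟩ := hc; exact ⟨a, b, hab, hne⟩
    exact Matrix.det_zero_of_column_eq hne (fun i => by simp [hj])
  -- a non-zero kernel vector supported on the range of `c`
  obtain ⟨z, hz0, hzker, hzsupp⟩ : ∃ z : Col d → F, z ≠ 0 ∧
      (∀ e', ∑ col : Col d, rupMat d φ e' col * z col = 0) ∧ ∀ col, col ∉ Set.range c → z col = 0 := by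
    -- the complement of the range has at most one element
    have hcard : (Finset.univ.filter fun col : Col d => col ∉ Set.range c).card ≤ 1 := by
      have h1 : (Finset.univ.image c).card = m := by
        rw [Finset.card_image_of_injective _ hc, Finset.card_univ, Fintype.card_fin]
      have h2 : (Finset.univ.filter fun col : Col d => col ∉ Set.range c) =
          Finset.univ \ Finset.univ.image c := by
        ext col; simp
      rw [h2, Finset.card_sdiff_of_subset (Finset.subset_univ _), Finset.card_univ, h1]
      omega
    rcases Nat.lt_or_ge (Finset.univ.filter fun col : Col d => col ∉ Set.range c).card 1 with h0 | h1
    · -- the range is everything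
      have hall : ∀ col : Col d, col ∈ Set.range c := by
        intro col; by_contra hcol
        have : col ∈ Finset.univ.filter fun col : Col d => col ∉ Set.range c :=
          Finset.mem_filter.mpr ⟨Finset.mem_univ _, hcol⟩
        rw [Nat.lt_one_iff, Finset.card_eq_zero] at h0
        rw [h0] at this; simp at this
      exact ⟨x₁, hx₁0, hk₁, fun col hcol => absurd (hall col) hcol⟩
    · obtain ⟨j, hj⟩ := Finset.card_eq_one.mp (le_antisymm hcard h1)
      have hjmem : j ∉ Set.range c := by
        have : j ∈ Finset.univ.filter fun col : Col d => col ∉ Set.range c := by rw [hj]; simp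
        simpa using this
      have hothers : ∀ col : Col d, col ∉ Set.range c → col = j := by
        intro col hcol
        have : col ∈ Finset.univ.filter fun col : Col d => col ∉ Set.range c :=
          Finset.mem_filter.mpr ⟨Finset.mem_univ _, hcol⟩
        rw [hj] at this; simpa using this
      by_cases hx₁j : x₁ j = 0
      · exact ⟨x₁, hx₁0, hk₁, fun col hcol => by rw [hothers col hcol]; exact hx₁j⟩
      · refine ⟨x₂ j • x₁ - x₁ j • x₂, ?_, fun e' => ?_, fun col hcol => ?_⟩
        · intro hzero
          have := hindv (x₂ j) (-(x₁ j)) (by rw [neg_smul, ← sub_eq_add_neg]; exact hzero)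
          exact hx₁j (neg_eq_zero.mp this.2)
        · simp only [Pi.sub_apply, Pi.smul_apply, smul_eq_mul, mul_sub, Finset.sum_sub_distrib]
          rw [show ∑ col : Col d, rupMat d φ e' col * (x₂ j * x₁ col) =
              x₂ j * ∑ col : Col d, rupMat d φ e' col * x₁ col by
                rw [Finset.mul_sum]; exact Finset.sum_congr rfl fun _ _ => by ring,
            show ∑ col : Col d, rupMat d φ e' col * (x₁ j * x₂ col) =
              x₁ j * ∑ col : Col d, rupMat d φ e' col * x₂ col by
                rw [Finset.mul_sum]; exact Finset.sum_congr rfl fun _ _ => by ring,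
            hk₁, hk₂, mul_zero, mul_zero, sub_zero]
        · rw [hothers col hcol]
          simp only [Pi.sub_apply, Pi.smul_apply, smul_eq_mul]
          ring
  -- transport to the submatrix
  refine (Matrix.exists_mulVec_eq_zero_iff).mp ⟨z ∘ c, ?_, ?_⟩
  · intro hzc
    apply hz0
    funext col
    by_cases hcol : col ∈ Set.range c
    · obtain ⟨i, rfl⟩ := hcol
      exact congrFun hzc i
    · exact hzsupp col hcol
  · funext i
    rw [Matrix.mulVec, Pi.zero_apply]
    change ∑ l, rupMat d φ (r i) (c l) * z (c l) = 0
    rw [← hzker (r i)]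
    rw [← Finset.sum_image (f := fun col => rupMat d φ (r i) col * z col)
      (fun a _ b _ hab => hc hab)]
    refine Finset.sum_subset (Finset.subset_univ _) fun col _ hcol => ?_
    rw [hzsupp col (by simpa [Set.mem_range, eq_comm] using hcol), mul_zero]

/-- **A non-irreducible `φ` has vanishing large minors** (Ruppert's Lemma 1 combined with the
dictionary): over a field in which `1, …, d` are non-zero, `deg φ ≤ d`, `φ` not irreducible, and
`m + 1 ≥ N`. [cite: Ruppert1999, §2 Lemma 1] -/
theorem rupMinor_eq_zero_of_not_irreducible {d : ℕ}
    (hchar : ∀ a : ℕ, 0 < a → a ≤ d → (a : F) ≠ 0) {φ : MvPolynomial (Fin 2) F}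
    (hdeg : φ.totalDegree ≤ d) (hφ : ¬ Irreducible φ) {m : ℕ} (hm : Fintype.card (Col d) ≤ m + 1)
    (r : Fin m → (Fin 2 →₀ ℕ)) (c : Fin m → Col d) : rupMinor d φ r c = 0 :=
  rupMinor_eq_zero_of_two_kernel_pairs (two_kernel_pairs_of_not_irreducible hchar hdeg hφ) hm r c

/-! ### A kernel line gives a non-zero minor of size `N − 1` -/

/-- The degree of `R_φ(G, H)` for a pair in the box is at most `2d`. [folklore] -/
theorem totalDegree_rupOp_le {d : ℕ} {φ G H : MvPolynomial (Fin 2) F} (hφ : φ.totalDegree ≤ d)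
    (hG : G.totalDegree ≤ d - 1) (hH : H.totalDegree ≤ d - 1) :
    (rupOp φ G H).totalDegree ≤ 2 * d := by
  unfold rupOp
  have h1 : (φ * pderiv 1 G).totalDegree ≤ 2 * d :=
    (totalDegree_mul _ _).trans (by
      have := (totalDegree_pderiv_le 1 G).trans (Nat.sub_le _ _); omega)
  have h2 : (G * pderiv 1 φ).totalDegree ≤ 2 * d :=
    (totalDegree_mul _ _).trans (by
      have := (totalDegree_pderiv_le 1 φ).trans (Nat.sub_le _ _); omega)
  have h3 : (φ * pderiv 0 H).totalDegree ≤ 2 * d :=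
    (totalDegree_mul _ _).trans (by
      have := (totalDegree_pderiv_le 0 H).trans (Nat.sub_le _ _); omega)
  have h4 : (H * pderiv 0 φ).totalDegree ≤ 2 * d :=
    (totalDegree_mul _ _).trans (by
      have := (totalDegree_pderiv_le 0 φ).trans (Nat.sub_le _ _); omega)
  refine (totalDegree_add _ _).trans (max_le ?_ h4)
  refine (totalDegree_sub _ _).trans (max_le ?_ h3)
  exact (totalDegree_sub _ _).trans (max_le h1 h2)

/-- **A kernel line gives a non-zero minor of size `N − 1`.** If every kernel pair of `R_φ` in
the box is a multiple of `(P, Q)` (in applications `(φ_X, φ_Y)`), and the coefficient vector of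
`(P, Q)` has a non-zero coordinate `j₀`, then some minor of Ruppert's matrix of size `N − 1` is
non-zero (Ruppert: "there is a submatrix `M₀` of `M(f)` with `det M₀ ≠ 0`"). [cite: Ruppert1999, §2] -/
theorem exists_rupMinor_ne_zero_of_kernel_line {d : ℕ} {φ P Q : MvPolynomial (Fin 2) F}
    (hφ : φ.totalDegree ≤ d)
    (hker : ∀ G H : MvPolynomial (Fin 2) F, G.totalDegree ≤ d - 1 → H.totalDegree ≤ d - 1 →
      rupOp φ G H = 0 → ∃ a : F, G = a • P ∧ H = a • Q)
    (j₀ : Col d) (hj₀ : pairVec d P Q j₀ ≠ 0) :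
    ∃ (k : ℕ) (_ : k + 1 = Fintype.card (Col d)) (r : Fin k → (Fin 2 →₀ ℕ)) (c : Fin k → Col d),
      rupMinor d φ r c ≠ 0 := by
  classical
  set N := Fintype.card (Col d) with hN
  -- enumerate the columns other than `j₀`
  have hcardc : Fintype.card {col : Col d // col ≠ j₀} = N - 1 := by
    rw [Fintype.card_subtype_compl, Fintype.card_subtype_eq]
  let ec : Fin (N - 1) ≃ {col : Col d // col ≠ j₀} := (Fintype.equivFinOfCardEq hcardc).symm
  let c : Fin (N - 1) → Col d := fun i => (ec i).1
  have hc : Function.Injective c := fun a b hab => ec.injective (Subtype.ext hab)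
  have hcj : ∀ i, c i ≠ j₀ := fun i => (ec i).2
  -- the columns of the matrix on the finite row set `box (2d)`, as vectors
  let b : Fin (N - 1) → box (2 * d) → F := fun j e' => rupMat d φ e'.1 (c j)
  have hb : LinearIndependent F b := by
    rw [Fintype.linearIndependent_iff]
    intro y hy
    -- extend `y` by zero at `j₀`
    let x : Col d → F := fun col => if h : col = j₀ then 0 else y (ec.symm ⟨col, h⟩)
    have hxc : ∀ i, x (c i) = y i := by
      intro i
      simp only [x, dif_neg (hcj i)]
      congr 1
      have : (⟨c i, hcj i⟩ : {col : Col d // col ≠ j₀}) = ec i := Subtype.ext rfl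
      rw [this, Equiv.symm_apply_apply]
    have hxj : x j₀ = 0 := by simp [x]
    -- the pair with coefficient vector `x` is a kernel pair
    set G := (vecPair d x).1 with hG
    set H := (vecPair d x).2 with hH
    have hdegs := totalDegree_vecPair_le d x
    have hcoeff : ∀ e', coeff e' (rupOp φ G H) = ∑ col : Col d, rupMat d φ e' col * x col :=
      fun e' => coeff_rupOp_vecPair d φ x e'
    have hsum : ∀ e', ∑ col : Col d, rupMat d φ e' col * x col =
        ∑ i : Fin (N - 1), rupMat d φ e' (c i) * y i := by
      intro e'
      have : ∑ col : Col d, rupMat d φ e' col * x col =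
          ∑ col ∈ Finset.univ.image c, rupMat d φ e' col * x col := by
        refine (Finset.sum_subset (Finset.subset_univ _) fun col _ hcol => ?_).symm
        have hne : col = j₀ := by
          by_contra h
          apply hcol
          refine Finset.mem_image.mpr ⟨ec.symm ⟨col, h⟩, Finset.mem_univ _, ?_⟩
          simp [c]
        rw [hne, hxj, mul_zero]
      rw [this, Finset.sum_image (fun a _ b _ hab => hc hab)]
      exact Finset.sum_congr rfl fun i _ => by rw [hxc]
    have hR : rupOp φ G H = 0 := by
      ext e'
      rw [coeff_zero, hcoeff, hsum]
      by_cases he' : e' ∈ box (2 * d)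
      · have := congrFun hy ⟨e', he'⟩
        simpa [b, Finset.sum_apply, Pi.smul_apply, smul_eq_mul, mul_comm] using this
      · -- outside the box the row is identically zero
        have hzero : ∀ col : Col d, rupMat d φ e' col = 0 := by
          intro col
          unfold rupMat
          have hdeg : (rupOp φ (colPair d col).1 (colPair d col).2).totalDegree ≤ 2 * d := by
            refine totalDegree_rupOp_le hφ ?_ ?_ <;>
            · unfold colPair; split_ifs <;>
                first
                | exact (totalDegree_monomial_le _ _).trans (mem_box.mp col.2.2)
                | simp
          by_contra hne
          exact he' (support_subset_box hdeg (mem_support_iff.mpr hne))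
        simp [hzero]
    obtain ⟨a, hGa, hHa⟩ := hker G H hdegs.1 hdegs.2 hR
    -- hence `x = a • pairVec P Q`, and `x j₀ = 0` forces `a = 0`
    have hx : x = a • pairVec d P Q := by
      have h1 : pairVec d G H = x := pairVec_vecPair d x
      rw [← h1, hGa, hHa, pairVec_smul]
    have ha : a = 0 := by
      have := congrFun hx j₀
      rw [hxj, Pi.smul_apply, smul_eq_mul] at this
      exact (mul_eq_zero.mp this.symm).resolve_right hj₀
    intro i
    rw [← hxc i, hx, ha, zero_smul, Pi.zero_apply]
  obtain ⟨r, hr⟩ := exists_rows_det_ne_zero (N - 1) b hb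
  have hN1 : N - 1 + 1 = N := by have := two_le_card_Col d; omega
  exact ⟨N - 1, hN1, fun i => (r i).1, c, hr⟩

end Ruppert

end Literature.RingTheory.MvPolynomial

end
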